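/- Copyright: the b2b-balaban cell (near-miss cell 7), T⁴-continuum fan-out; row NE7b CRUX team (2), OWNER seat
t4-ne7b-p1 (gen 54) — (α)-JOINT AT THE CENSUS LETTERS, part 3: THE JOINT WITNESS AT `d = 4`, `L = 13`, `M = 13`, `β₀ = 1∕7`.
Released under the licence of the surrounding project. -/
import Summits.QuantumFields.BalabanUV.T4Continuum.Support.HistoryRealiseCellsRunAssemblyWTVSJointRecordD
import Summits.QuantumFields.BalabanUV.T4Continuum.Support.HistoryRealiseCellsRunAssemblyWTVSJointWitness
import Summits.QuantumFields.BalabanUV.T4Continuum.Support.HistoryRealiseCellsRunAssemblyWTVSJointLetters13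

/-!
# (α)-JOINT AT THE CENSUS LETTERS, part 3: `continuumYM4Torus_of_histReadingLWL_fsc` APPLIED AT RECORD DIMENSION `d = 4`
ON THE JOINT DATUM OF THE FAMILY `L = 13`, WITH PRINT's BLOCK CONSTANT `M = 13` AND `β₀ = 1∕7`, EVERY BINDER DISCHARGED
(owner lineage `t4-ne7b-p1` gen 54; sequel of IR-54-1 (J3c) `…JointWitness`)

Summits-side support leaf of the T⁴-continuum cell (rung (B)+1 on a FINITE torus only; NOT infinite volume, NOT the
mass gap, NOT Clay; NOT a proof of NE7b — the cell's OWN estimate, NOT PRINTED, NOT PROVED).  [decided toy] over parts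
0 (`JointLetters13`: `C₁₃`, `O₄`, the letter binders at the census letters), 1∕2 (`JointReadingD` ∕ `JointRecordD`: `ℛ₆ d`,
`histReadDataLWL₆ d`), IR-54-1's `JointDatum` (`jointData F`), `JointReading` (`flowRows_of_tuned`) and `JointWitness`
(`ZD_jointData…`), and leaf-05's toy suppliers, REUSED BY NAME; one `def` (the family `F₁₃`), nothing printed asserted,
no `def … : Prop` fact, no cite-tagged hypothesis, zero `sorry`.

WHY.  IR-54-1's `continuumYM4Torus_jointData` (p306709) certifies joint satisfiability of the terminal antecedent at
SOME letters (`d = 1`, `L = 87781`).  The predictable objection — «a toy dimension and a huge blocking parameter» — is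
met here: the SAME certificate at the letters the cell's census is booked at, `d = 4`, `L = 13`, `M = 13`, collar
`c = 32` (ROW-NE7b-STATE §4; balaban-calc G37–G40), with print's `β₀ = 1∕7` ([B16] p. 389).  The only letter that moves
is the count's smallness step `sS := 34` (forced `≥ 34` at `L = 13`, `d = 4`: `JointLetters13.not_hsmall_13_32`) with
`θc := 49∕50`.

WHAT.  §1 `histReadDataLWL_jointData₄` — the lattice-unit record AT `d = 4` on the joint datum of ANY family along runs
carrying the seven flow rows, for every loop string, at `(C₁₃, O₄)`, `rr = n = 1`, `θᵥ = 1∕8`, `cΛ = M = Lr = Φ = 0`,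
`b₀`, census `(8, 1, 2, 9, 1, 11)`; **`forSmallCouplings_histReadDataLWL_jointData₄`** — the terminal's `hRead` at `d = 4`
ON THE DATUM for every tuned bare sequence and every loop string (`b₀ := 1∕F.L`).  §2 `F₁₃ : T4Family` (`L := 13`,
`m := 1`) and **`continuumYM4Torus_jointData₁₃ : ContinuumYM4Torus (jointData F₁₃)` PROVED BY
`continuumYM4Torus_of_histReadingLWL_fsc` at `d := 4`** with `thresholdOK_C₁₃` + the seventeen letters of
`joint_outside_C₁₃`; `continuumYM4TorusE_jointData₁₃`; `jointWitness₁₃`.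

HONEST.  THE CERTIFIED SENTENCE: «the hypothesis set of the (α) road's terminal theorem of record p303949 is JOINTLY
SATISFIABLE AT THE CENSUS LETTERS `d = 4`, `L = 13`, `M = 13`, `β₀ = 1∕7` (smallness step `sS = 34`), on a datum whose
`ForSmallCouplings` range is non-empty».  The datum is still the DEGENERATE one-point theory `SU(1)` (no field, no action,
no large field; (B) by the abstract form-clause and `1 ≤ 1 ≤ 1`; H3-side fields VACUOUS on the no-region reading; the
NE7∕NE7c sockets exact because every generating function is `e^t`); print's `γ₀`, `A₁`, `o…` and every model constant
of `C₁₃` are unvalued symbols (ρ = cΛ∕c_{E₂} UNVALUED).  Nothing of Bałaban's is discharged, valued or asserted; every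
R-class row of the wall stays for real data; NE7b NOT PRINTED ∕ NOT PROVED; spine 0∕9.  HONEST DEPENDENCY (cell):
continuum YM on T⁴ ⇐ BetaPertH ∧ nine spine estimates (0/9 proved); BetaPertH ⇐ (D1) ∧ (D4) ∧ CAP+tail; G-an2-4 gates
asym, D1 and NE2/3/4.  Unchanged here.
-/

open Finset MeasureTheory
open Literature.MathematicalPhysics.QuantumFieldTheory.Balaban1983to89
open Literature.MathematicalPhysics.QuantumFieldTheory.Balaban1983to89.B16SProfile (DropCtl)
open Literature.MathematicalPhysics.QuantumFieldTheory.Balaban1983to89.T4ContinuumYM4Torus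
open T4PersistenceDictionary T4PersistentHistoryCount T4BankedInduction T4PrintedShapeBanking
open T4WeightBudget T4GlobalDenominator T4LiveClassFibration T4LiveStructureGas T4LiveGasToTerms T4RecordPriceSeam
open T4PartnerMultiplicity T4IndicatorShell T4MatchingAssembly T4MatchingClosure T4MatchingClosureSocket T4Continuum
open T4StabilitySocket T4BranchingRecordsGas T4TaggedShapeBanking T4CanonicalMenus T4RenewalChains
open Summit.QuantumFields.BalabanUV.T4Continuum.HistoryFlow Summit.QuantumFields.BalabanUV.T4Continuum.HistoryGen
open Summit.QuantumFields.BalabanUV.T4Continuum.HistoryGenealogyRealise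
open Summit.QuantumFields.BalabanUV.T4Continuum.HistoryAssemblyRealiseRun
open Summit.QuantumFields.BalabanUV.T4Continuum.HistoryRealiseCellsRunApexT3bWTVS
open Summit.QuantumFields.BalabanUV.T4Continuum.B16HistoryIndexedRepr
open Summit.QuantumFields.BalabanUV.T4Continuum.B16HistoryIndexedTrunc
open Summit.QuantumFields.BalabanUV.T4Continuum.HistoryConstants
open Summit.QuantumFields.BalabanUV.T4Continuum.HistoryRealiseCellsRunAssemblyWTVSDataLWL
open Summit.QuantumFields.BalabanUV.T4Continuum.HistoryRealiseCellsRunAssemblyWTVSLWLP82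
open Summit.QuantumFields.BalabanUV.T4Continuum.HistoryRealiseCellsRunAssemblyWTVSSanity
open Summit.QuantumFields.BalabanUV.T4Continuum.HistoryRealiseCellsRunAssemblyWTVSJointReading
open Summit.QuantumFields.BalabanUV.T4Continuum.HistoryRealiseCellsRunAssemblyWTVSJointRecord
open Summit.QuantumFields.BalabanUV.T4Continuum.HistoryRealiseCellsRunAssemblyWTVSJointDatum
open Summit.QuantumFields.BalabanUV.T4Continuum.HistoryRealiseCellsRunAssemblyWTVSJointReadingD
open Summit.QuantumFields.BalabanUV.T4Continuum.HistoryRealiseCellsRunAssemblyWTVSJointRecordD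
open Summit.QuantumFields.BalabanUV.T4Continuum.HistoryRealiseCellsRunAssemblyWTVSJointWitness
open Summit.QuantumFields.BalabanUV.T4Continuum.HistoryRealiseCellsRunAssemblyWTVSJointLetters13
open Summit.QuantumFields.BalabanUV.T4Continuum.CountThresholdUniform (ThresholdOK)
open Summit.QuantumFields.BalabanUV.T4Continuum.HistoryBankingSharpShares (ell)
open Summit.QuantumFields.BalabanUV.T4Continuum.HistoryBankingVolumeWindowLattice (uvolL)

namespace Summit.QuantumFields.BalabanUV.T4Continuum.HistoryRealiseCellsRunAssemblyWTVSJointWitness13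

noncomputable section

-- the structural `DecidableEq` instance of the concrete tag type exceeds the default synthesis size (as in the siblings)
set_option synthInstance.maxSize 1024

open B16HistoryIndexedRepr.Sanity B16HistoryIndexedRepr.SanityInput HistoryConstants.Sanity

/-! ## §1 The record at `d = 4` on the joint datum; the terminal's `hRead` at `d = 4` -/

section Record

variable (F : T4Family)

/-- **`HistReadDataLWL` AT `d = 4` ON THE JOINT DATUM** for a bare sequence `g₀` whose runs carry the seven flow rows with
sizes `R` at `(β′, b₀)`, for EVERY loop string `os`, at `(C₁₃, O₄)`, `rr = n = 1`, `θᵥ := 1∕8`, `cΛ = M = Lr = Φ := 0`,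
census `(p₁, η, η′, κ, κ₂, κᵥ) = (8, 1, 2, 9, 1, 11)` — part 2's `histReadDataLWL₆ 4` with every remaining input discharged on
the datum (IR-54-1 `JointWitness` §1). [decided toy] -/
def histReadDataLWL_jointData₄ {b₀ : ℝ} (hb₀ : 0 ≤ b₀) (β' : ℝ) (g₀ : ℕ → ℝ) (os : List (ULoop F)) (R : ℕ → ℕ → ℕ)
    (isRj : ∀ K s, s ≤ K → B14.IsRj F.L 1 (((jointData F).C ⟨K, F.m, g₀ K⟩).flow.g s) (R K s))
    (hR2 : ∀ K t, 2 ≤ R K t)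
    (h27 : ∀ K, B14.FlowIneq27 ((jointData F).C ⟨K, F.m, g₀ K⟩).flow.g β' b₀ 1 K)
    (h29 : ∀ K, B14FlowStep.FlowIneq29 (R K) ((jointData F).C ⟨K, F.m, g₀ K⟩).flow.g F.L β' b₀ K)
    (hprof : ∀ K t, t < K → runProfile F.L R K (t + 1) ≤ runProfile F.L R K t)
    (hdrop : ∀ K m, DropCtl (runProfile F.L R K) m)
    (hx1 : ∀ K s, s ≤ K → 1 ≤ Real.log ((((jointData F).C ⟨K, F.m, g₀ K⟩).flow.g s) ^ 2)⁻¹) :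
    HistReadDataLWL (jointData F) C₁₃ O₄ (1 / 8) 1 4 1 one_pos g₀ os 0 0 0 0 b₀ 8 1 2 9 1 11 Isk Isk (fun _ => Unit) μ₀
      (fun _ => GoodClass.top Unit) (fun _ => Unit) μ₀ (fun _ => GoodClass.top Unit) :=
  histReadDataLWL₆ 4 (jointData F) (avgMeasurable_jointData F) (C := C₁₃) (O := O₄) (by norm_num) (by norm_num)
    (by norm_num) (by norm_num) (by norm_num) (by norm_num [O₄]) (by norm_num [O₄]) (by norm_num [O₄])
    (by norm_num [O₄]) (by norm_num) 1 1 one_pos g₀ os R hR2 le_rfl le_rfl le_rfl le_rfl hb₀ β' le_rfl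
    (by decide) (by decide) (by decide) (by decide) (by decide) (by decide) le_rfl (by norm_num) (by norm_num)
    le_rfl (by norm_num) (ZD_jointData_le F g₀ os) isRj
    (fun K t => one_le_lamVolL le_rfl le_rfl (fun j hj => hx1 K j hj) t) h27 h29 hprof hdrop (c₀ := 1) (n₁ := 0)
    one_pos (fun K => (smallFieldMass_jointData F K _).symm.le) (fun K => (smallFieldMass_jointData F (K + 1) _).symm.le)
    (fun K => by simp) (fun K => by simp) (shell_toyR _)
    (budget_toyR (fun K t _ => ZD_jointData_pos F g₀ os K t) _ (ZD_jointData_succ F g₀ os) _)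
    summable_zero summable_zero summable_zero summable_zero

/-- **THE TERMINAL's `hRead` AT `d = 4` ON THE JOINT DATUM**: for all small `γ`, EVERY bare sequence tuned within `]0, γ]`
and EVERY loop string, the record is inhabited (flow rows by `flowRows_of_tuned` from `BetaPertHyp` at `b₀ := 1∕F.L`).
[decided toy] -/
theorem forSmallCouplings_histReadDataLWL_jointData₄ :
    ForSmallCouplings (jointData F) fun g₀ => ∀ os : List (ULoop F),
      ∃ (DomK : ℕ → Type) (I : (K : ℕ) → HIndex (DomK K)) (_ : DecidableEq (HIndex.Idx I)) (DomK' : ℕ → Type)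
        (I' : (K : ℕ) → HIndex (DomK' K)) (X : ℕ → Type) (_ : ∀ K, MeasurableSpace (X K))
        (μ : (K : ℕ) → Measure (X K)) (_ : ∀ K, IsFiniteMeasure (μ K)) (𝒢 : (K : ℕ) → GoodClass (X K))
        (Y : ℕ → Type) (_ : ∀ K, MeasurableSpace (Y K)) (νB : (K : ℕ) → Measure (Y K))
        (_ : ∀ K, IsFiniteMeasure (νB K)) (𝒢' : (K : ℕ) → GoodClass (Y K)),
        Nonempty (HistReadDataLWL (jointData F) C₁₃ O₄ (1 / 8) 1 4 1 one_pos g₀ os 0 0 0 0 (1 / (F.L : ℝ))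
          8 1 2 9 1 11 I I' X μ 𝒢 Y νB 𝒢') := by
  have hL : (2 : ℝ) ≤ F.L := by exact_mod_cast two_le_L F
  have hb₀ : (0 : ℝ) < 1 / (F.L : ℝ) := by positivity
  have hb₁ : 1 / (F.L : ℝ) ≤ 1 / 2 := one_div_le_one_div_of_le (by norm_num) hL
  have hLb : (F.L : ℝ) * (1 / (F.L : ℝ)) ≤ 1 := by rw [mul_one_div_cancel (by linarith)]
  obtain ⟨γ₁, hγ₁, β', hflow⟩ := flowRows_of_tuned (jointData F) (betaPertHyp_jointData F) hb₀ hb₁ hLb (rr := 1) le_rfl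
  refine ⟨γ₁, hγ₁, fun γ hγ hγle => ⟨1, one_pos, fun g _ _ g₀ ht os => ?_⟩⟩
  obtain ⟨R, hR, hR2, h27, h29, hprof, hdrop, hx1⟩ := hflow γ hγ hγle g g₀ ht
  exact ⟨_, Isk, inferInstance, _, Isk, fun _ => Unit, inferInstance, μ₀, inferInstance, _, fun _ => Unit,
    inferInstance, μ₀, inferInstance, _,
    ⟨histReadDataLWL_jointData₄ F hb₀.le β' g₀ os R hR hR2 h27 h29 hprof hdrop hx1⟩⟩

end Record

/-! ## §2 The joint witness at the census letters -/

/-- **THE CENSUS FAMILY**: blocking parameter `L := 13` (odd, `> 11` — the cell's `L`), torus exponent `m := 1`.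
[decided toy] -/
def F₁₃ : T4Family := ⟨13, ⟨⟨6, by norm_num⟩, by norm_num⟩, by norm_num, 1, le_rfl⟩

/-- its blocking parameter is `13` [decided toy] -/
@[simp] theorem F₁₃_L : F₁₃.L = 13 := rfl

/-- **THE JOINT WITNESS AT THE CENSUS LETTERS.**  `continuumYM4Torus_of_histReadingLWL_fsc` (p303949) APPLIED at record
dimension `d := 4` to the joint datum `jointData F₁₃` (`L = 13`) with EVERY binder discharged: `hBA`, `hE`, `hB`, `hβ`,
`hsign` (IR-54-1 `JointDatum`); `ThresholdOK C₁₃ 13 1 (1∕13)` and the seventeen letter binders at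
`(d, n, θ, θv, sS, θc, β₀) = (4, 1, 1∕8, 1∕8, 34, 49∕50, 1∕13)` against `O₄ = ⟨4, 13, 2, 1, 1∕7, …⟩` (part 0); `hRead` (§1).
[decided toy] -/
theorem continuumYM4Torus_jointData₁₃ : ContinuumYM4Torus (jointData F₁₃) := by
  obtain ⟨hμ, hκ₁, hE₀, hA₀, hβ₀, hLβ, hn₁, hn, hθ, hslack, hE₂, hE₃, hsS, hsmall, hθc0, hθc1, hθcs⟩ := joint_outside_C₁₃
  exact continuumYM4Torus_of_histReadingLWL_fsc (jointData F₁₃) (isBlockAveraged_jointData F₁₃)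
    LoopAverage.measurableE_trivial (endStatementBPrinted_jointData F₁₃) (betaPertHyp_jointData F₁₃)
    (signConventions_jointData F₁₃) thresholdOK_C₁₃ hμ 4 1 hκ₁ hE₀ hA₀ hβ₀ hLβ hn₁ hn hθ hslack hE₂ hE₃ hsS hsmall hθc0
    hθc1 hθcs (forSmallCouplings_histReadDataLWL_jointData₄ F₁₃)

/-- … and the ∃-form (the `ForSmallCouplings` range is NOT empty on `jointData F₁₃`). [decided toy] -/
theorem continuumYM4TorusE_jointData₁₃ : ContinuumYM4TorusE (jointData F₁₃) :=
  continuumYM4TorusE_of_betaPertHyp (betaPertHyp_jointData F₁₃) continuumYM4Torus_jointData₁₃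

/-- THE CERTIFICATE AT THE CENSUS LETTERS IN ONE LINE. [decided toy] -/
theorem jointWitness₁₃ : ContinuumYM4Torus (jointData F₁₃) ∧ ContinuumYM4TorusE (jointData F₁₃) :=
  ⟨continuumYM4Torus_jointData₁₃, continuumYM4TorusE_jointData₁₃⟩

end

end Summit.QuantumFields.BalabanUV.T4Continuum.HistoryRealiseCellsRunAssemblyWTVSJointWitness13
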